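import Literature.Barriers.CriticalPhenomena.LaceExpansionFractionalSmearBounds
import Literature.Barriers.CriticalPhenomena.LaceExpansionXSpaceNormsReduction
import Literature.Barriers.CriticalPhenomena.LaceExpansionXSpaceNormsTorus
import HarnessLib

/-!
# The fractional engine of Hara's Lemma 1.7: `G_j^{(β)} = |x_j|^β τ_{p_c}(0,x)` is `L^p`-dominated
# for non-integer `β < ⌊φ⌋` and `(2 + β)p < d` — PROVED

Barrier catalogue `Literature/Barriers/CriticalPhenomena/` (D-0021), support file for the
discharge of the named fact `Hara2008_lemma17Pc` (`LaceExpansionXSpaceNorms.lean`: Hara 2008,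
Lemma 1.7). `LaceExpansionXSpaceNormsProofs.lean` reduced the fact to two analytic inputs; this
file discharges the first one — the hypothesis `hfrac` of `Hara2008_lemma17Pc_of_engines` — by
putting together three pipelines of the tree:

* the Lemma 4.1 pipeline (`LaceExpansionHaraLemma41.lean`, `…Lemma17G.lean`, `…Lemma41Cube.lean`:
  `|∂_l^m Ĝ| ≤ C/|k|^{2+m}` on the punctured cube, `C^M` and `2π`-periodic slices, the identity (4.8));
* the dyadic second-difference smear (`LaceExpansionFractionalSmear.lean`, `…SmearBounds.lean`:
  `w_θ(t) ≍ |t|^θ`, `IsFourierPair.fracWeight_mul`, `FracSmear.SliceBound`,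
  `FracSmear.lintegral_rpow_smear_lt_top`);
* the `x`-space layer (`LaceExpansionXSpaceNormsReduction.lean`: `HaraNorms.LpDominated`, `coordG`).

Contents (all PROVED): `isPeriodicIn_sliceDeriv_kspaceTwoPoint`; the slice bounds of Hara's type
for `∂_l^m Ĝ` with `m + r ≤ M` (`exists_sliceBound_sliceDeriv_kspaceTwoPoint`: decay `2 + m`,
smoothness `r`, from Lemma 4.1 at the orders `m` and `m + r`); at `p_c`: the zero set of `1 - Ĵ`
is inside `2πℤ^d`, hence null (`IsLaceCoefficientPc.volume_setOf_one_sub_latticeFT_eq_zero`), so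
`∂_l^m Ĝ` and its translates are a.e.-strongly measurable
(`…aestronglyMeasurable_sliceDeriv(_shift)`); the Fourier pair `x_l^{2b} G ↔ (-1)^b ∂_l^{2b} Ĝ`
(`…isFourierPair_coordG_even`); and **the engine** `IsLaceCoefficientPc.lpDominated_coordG_frac`
(`_of_rpow`, `Hara2008_lemma17Pc_hfrac`): for non-integer `β = 2b + θ > 0` (`0 < θ < 2`, `θ ≠ 1`)
with `⌈β⌉ ≤ M` and `(2 + β)p < d`, `p ≥ 1`,
`|x_l|^β G ≤ c_θ^{-1} w_θ(x_l) x_l^{2b} G`, represented by `c_θ^{-1} T_θ[(-1)^b ∂_l^{2b} Ĝ] ∈ L^p` —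
Hara's Lemma 4.2 / §4.1.3 ("finite as long as `2 + n - ε < d`") with finite differences in place of
the fractional-derivative kernels of §4.3.

What remains for `Hara2008_lemma17Pc_holds` after this file: the top exponents `⌊φ⌋ < α ≤ φ`,
`α < d - 2` of the `Ḡ`-clause (§4.1.4; hypothesis `htop` of `Hara2008_lemma17Pc_of_engines`).

## References

* T. Hara, Ann. Probab. 36 (2008) 530–593 (arXiv:math-ph/0504021): Lemma 1.7 (§1.2.4), §4.1.2
  ((4.8)), §4.1.3 (Lemma 4.2, (4.16)–(4.17)), Lemma 4.1, §4.3 (fractional powers).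
-/

noncomputable section

namespace Literature.Barriers.CriticalPhenomena

open _root_.MeasureTheory _root_.Filter Finset Literature.Probability.LatticeModels
  Literature.Probability.Percolation HaraNorms FracSmear

open scoped ENNReal NNReal BigOperators Topology

/-! ### Generic facts about `∂_l^m Ĝ` under the hypotheses of Lemma 4.1 -/

section Generic

variable {n : ℕ} {J g : Site (n + 1) → ℝ} {M : ℕ}

/-- `∂_l^m Ĝ` is `2π`-periodic in `k_l` (the slice `s ↦ Ĝ(k[l ↦ s])` is `2π`-periodic, hence so
are its derivatives). [cite: Hara2008, §1.1 (periodicity of f̂) and Lemma 4.1] -/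
theorem isPeriodicIn_sliceDeriv_kspaceTwoPoint (l : Fin (n + 1)) (m : ℕ) :
    IsPeriodicIn l (sliceDeriv (kspaceTwoPoint J g) l m) := by
  intro k
  unfold sliceDeriv
  simp only [Function.update_idem, Function.update_self]
  have hper : Function.Periodic (fun s : ℝ => kspaceTwoPoint J g (Function.update k l s)) (2 * Real.pi) := by
    intro s
    simp only [kspaceTwoPoint, latticeFT_update_add_two_pi]
  exact iteratedDeriv_periodic hper m (k l)

/-- Iterating iterated derivatives: `(f^{(m)})^{(r)} = f^{(r+m)}`. [folklore] -/
theorem iteratedDeriv_iteratedDeriv_eq (r m : ℕ) (f : ℝ → ℂ) :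
    iteratedDeriv r (iteratedDeriv m f) = iteratedDeriv (r + m) f := by
  rw [iteratedDeriv_eq_iterate, iteratedDeriv_eq_iterate, iteratedDeriv_eq_iterate]
  funext x
  rw [Function.iterate_add_apply]

/-- The slices of `∂_l^m Ĝ` are the `m`-th derivatives of the slices of `Ĝ`. [folklore] -/
theorem sliceDeriv_insertNth_fun (F : (Fin (n + 1) → ℝ) → ℂ) (l : Fin (n + 1)) (m : ℕ) (k' : Fin n → ℝ) :
    (fun s : ℝ => sliceDeriv F l m (l.insertNth s k')) = iteratedDeriv m (fun s : ℝ => F (l.insertNth s k')) := by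
  funext s
  exact sliceDeriv_insertNth F l m s k'

/-- **Slice bounds of Hara's type for `∂_l^m Ĝ`**: under the hypotheses of Lemma 4.1
(`Σ_x (1+|x|)^M (|J| + |g|) < ∞`, `M ≥ 2`, `J` `ℤ^d`-symmetric, `c₀|k|² ≤ |1 - Ĵ|` on the cube) and
for `m + r ≤ M`, the function `∂_l^m Ĝ` obeys `FracSmear.SliceBound` along `l` with decay exponent
`2 + m`, smoothness order `r` and some constant `C ≥ 0`: periodicity, `C^r` slices off the axis,
`|∂_l^m Ĝ| ≤ C/|k|^{2+m}` and `|∂_s^r ∂_l^m Ĝ| = |∂_l^{m+r} Ĝ| ≤ C/|k|^{2+m+r}` (Lemma 4.1 at the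
orders `m` and `m + r`). [cite: Hara2008, Lemma 4.1 ((4.6)–(4.7)) and §4.1.2] -/
theorem exists_sliceBound_sliceDeriv_kspaceTwoPoint (hM2 : 2 ≤ M)
    (hJ : Summable fun x => (1 + euclidNorm x) ^ M * |J x|)
    (hg : Summable fun x => (1 + euclidNorm x) ^ M * |g x|) (hJs : IsZdSymmetric J)
    {c₀ : ℝ} (hc₀ : 0 < c₀) (hlow : ∀ k ∈ cube (n + 1), c₀ * knorm k ^ 2 ≤ ‖1 - latticeFT J k‖)
    (l : Fin (n + 1)) {m r : ℕ} (hmr : m + r ≤ M) :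
    ∃ C : ℝ, 0 ≤ C ∧ SliceBound (sliceDeriv (kspaceTwoPoint J g) l m) l ((2 + m : ℕ) : ℝ) r C := by
  have hm : m ≤ M := by omega
  obtain ⟨C₁, hC₁⟩ := norm_sliceDeriv_kspaceTwoPoint_le hM2 hJ hg hJs hc₀ hlow l hm
  obtain ⟨C₂, hC₂⟩ := norm_sliceDeriv_kspaceTwoPoint_le hM2 hJ hg hJs hc₀ hlow l hmr
  set C : ℝ := max 0 (max C₁ C₂) with hC
  have hC0 : 0 ≤ C := le_max_left _ _
  have hC1 : C₁ ≤ C := (le_max_left _ _).trans (le_max_right _ _)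
  have hC2 : C₂ ≤ C := (le_max_right _ _).trans (le_max_right _ _)
  refine ⟨C, hC0, ⟨isPeriodicIn_sliceDeriv_kspaceTwoPoint l m, fun k' hk' hk'0 => ?_, fun k hk hk0 => ?_,
    fun k' hk' hk'0 s hs => ?_⟩⟩
  · -- `C^r` slices
    obtain ⟨hF, -⟩ := contDiff_kspaceTwoPoint_insertNth hJ hg hc₀ hlow l hk' hk'0
    rw [sliceDeriv_insertNth_fun, iteratedDeriv_eq_iterate]
    exact ContDiff.iterate_deriv' r m (hF.of_le (by exact_mod_cast (by omega : r + m ≤ M)))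
  · -- the envelope
    rw [Real.rpow_natCast]
    exact (hC₁ k hk hk0).trans (div_le_div_of_nonneg_right hC1 (pow_nonneg (knorm_nonneg _) _))
  · -- the `r`-th slice derivative is `∂_l^{m+r} Ĝ`
    rw [sliceDeriv_insertNth_fun, iteratedDeriv_iteratedDeriv_eq,
      show ((2 + m : ℕ) : ℝ) + (r : ℕ) = ((2 + (m + r) : ℕ) : ℝ) by push_cast; ring, Real.rpow_natCast,
      show r + m = m + r from Nat.add_comm r m]
    exact (norm_iteratedDeriv_slice_le hC₂ hk' hk'0 hs).trans
      (div_le_div_of_nonneg_right hC2 (pow_nonneg (knorm_nonneg _) _))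

end Generic

/-! ### At `p_c`: measurability of the shifts, the Fourier pair of `x_l^{2b} G`, and the engine -/

section AtPc

variable {d : ℕ} {Φ : Site d → ℝ}

/-- The zero set of `1 - Ĵ` is contained in `2πℤ^d` (the infrared bound
`c₁ ω(k)²/d ≤ 1 - Re Ĵ(k)` off the cube), hence is a Lebesgue null set. [cite: Hara2008, Prop. 1.2 (infrared bound)] -/
theorem IsLaceCoefficientPc.volume_setOf_one_sub_latticeFT_eq_zero (h : IsLaceCoefficientPc d Φ) (hd : 1 ≤ d) :
    volume {k : Fin d → ℝ | (1 : ℂ) - latticeFT (laceKernel (criticalProbI d) Φ) k = 0} = 0 := by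
  obtain ⟨n, rfl⟩ : ∃ n, d = n + 1 := ⟨d - 1, by omega⟩
  obtain ⟨c₁, hc₁, hlow⟩ := h.lower
  have hsub : {k : Fin (n + 1) → ℝ | (1 : ℂ) - latticeFT (laceKernel (criticalProbI (n + 1)) Φ) k = 0} ⊆
      {k : Fin (n + 1) → ℝ | ∀ i, k i ∈ Set.range fun v : ℤ => (v : ℝ) * (2 * Real.pi)} := by
    intro k hk i
    have h1 := one_sub_re_latticeFT_ge_omega hlow k
    have hk' : (1 : ℝ) - (latticeFT (laceKernel (criticalProbI (n + 1)) Φ) k).re = 0 := by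
      have := congrArg Complex.re hk
      simpa using this
    rw [hk'] at h1
    have hd0 : (0 : ℝ) < (n + 1 : ℕ) := by exact_mod_cast hd
    have hω : omega k = 0 := by
      have h2 : c₁ * omega k ^ 2 / ((n + 1 : ℕ) : ℝ) ≤ 0 := h1
      have h3 : 0 ≤ c₁ * omega k ^ 2 / ((n + 1 : ℕ) : ℝ) :=
        div_nonneg (mul_nonneg hc₁.le (sq_nonneg _)) hd0.le
      have h4 : c₁ * omega k ^ 2 / ((n + 1 : ℕ) : ℝ) = 0 := le_antisymm h2 h3
      rcases div_eq_zero_iff.1 h4 with h5 | h5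
      · rcases mul_eq_zero.1 h5 with h6 | h6
        · exact absurd h6 hc₁.ne'
        · exact (pow_eq_zero_iff (n := 2) (by norm_num)).1 h6
      · exact absurd h5 hd0.ne'
    have hred : red k = 0 := by
      by_contra hne
      exact (knorm_pos_of_ne_zero hne).ne' hω
    have hwrap : wrap (k i) = 0 := congrFun hred i
    obtain ⟨v, hv⟩ := exists_wrap_eq (k i)
    refine ⟨-v, ?_⟩
    rw [hwrap] at hv
    push_cast
    linarith
  refine measure_mono_null hsub (Set.Countable.measure_zero ?_ _)
  exact Set.countable_pi fun _ => Set.countable_range _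

/-- `∂_l^m Ĝ` (at `p_c`, `m ≤ M`) is a.e.-strongly measurable on all of `ℝ^d`: it is continuous off the
null set `{1 - Ĵ = 0}`. [cite: Hara2008, Lemma 4.1] -/
theorem IsLaceCoefficientPc.aestronglyMeasurable_sliceDeriv (h : IsLaceCoefficientPc d Φ) (hd : 1 ≤ d)
    {M : ℕ} (hmom : Summable fun x => (1 + euclidNorm x) ^ M * |Φ x|) (l : Fin d) {m : ℕ} (hm : m ≤ M) :
    AEStronglyMeasurable (sliceDeriv (kspaceTwoPoint (laceKernel (criticalProbI d) Φ) (laceSource Φ)) l m)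
      (volume : Measure (Fin d → ℝ)) := by
  set U : Set (Fin d → ℝ) := {k | (1 : ℂ) - latticeFT (laceKernel (criticalProbI d) Φ) k ≠ 0} with hU
  have hUo : IsOpen U := by
    have hc : Continuous fun k : Fin d → ℝ => (1 : ℂ) - latticeFT (laceKernel (criticalProbI d) Φ) k :=
      continuous_const.sub (continuous_latticeFT (summable_abs_laceKernel h.summable_abs _))
    exact isOpen_ne_fun hc continuous_const
  have hcont := continuousOn_sliceDeriv_kspaceTwoPoint (J := laceKernel (criticalProbI d) Φ) (g := laceSource Φ)
    (summable_moment_laceKernel hmom (criticalProbI d)) (summable_moment_laceSource hmom) l hm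
  have h1 : AEStronglyMeasurable (sliceDeriv (kspaceTwoPoint (laceKernel (criticalProbI d) Φ) (laceSource Φ)) l m)
      ((volume : Measure (Fin d → ℝ)).restrict U) := hcont.aestronglyMeasurable hUo.measurableSet
  have hae : ∀ᵐ k ∂(volume : Measure (Fin d → ℝ)), k ∈ U := by
    rw [ae_iff]
    refine measure_mono_null (fun k hk => ?_) (h.volume_setOf_one_sub_latticeFT_eq_zero hd)
    simp only [hU, Set.mem_setOf_eq, not_not] at hk
    exact hk
  rwa [Measure.restrict_eq_self_of_ae_mem hae] at h1

/-- The shifts `k ↦ ∂_l^m Ĝ(k + t e_{l'})` are a.e.-strongly measurable on the cube (translations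
preserve Lebesgue measure). [folklore] -/
theorem IsLaceCoefficientPc.aestronglyMeasurable_sliceDeriv_shift {n : ℕ} {Φ : Site (n + 1) → ℝ}
    (h : IsLaceCoefficientPc (n + 1) Φ) {M : ℕ} (hmom : Summable fun x => (1 + euclidNorm x) ^ M * |Φ x|)
    (l l' : Fin (n + 1)) {m : ℕ} (hm : m ≤ M) (t : ℝ) :
    AEStronglyMeasurable (fun k => sliceDeriv (kspaceTwoPoint (laceKernel (criticalProbI (n + 1)) Φ)
      (laceSource Φ)) l m (shift l' t k)) ((volume : Measure (Fin (n + 1) → ℝ)).restrict (cube (n + 1))) := by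
  have h1 := h.aestronglyMeasurable_sliceDeriv (by omega) hmom l hm
  have hmp : MeasurePreserving (shift l' t) (volume : Measure (Fin (n + 1) → ℝ)) volume := by
    have : (shift l' t : (Fin (n + 1) → ℝ) → (Fin (n + 1) → ℝ)) = fun k => k + Function.update (0 : Fin (n + 1) → ℝ) l' t := by
      funext k; exact shift_eq_add l' t k
    rw [this]
    exact measurePreserving_add_right _ _
  exact (h1.comp_measurePreserving hmp).restrict

/-- **Hara's `G_l^{(2b)}` as a Fourier pair at `p_c`**: for `2b ≤ M`, `2b + 2 < d` (and
`Σ_x (1+|x|)^M |Π(x)| < ∞`, `M ≥ 2`), `x_l^{2b} τ_{p_c}(0,x)` is represented by `(-1)^b ∂_l^{2b} Ĝ`.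
[cite: Hara2008, §4.1.2 ((4.8))] -/
theorem IsLaceCoefficientPc.isFourierPair_coordG_even (h : IsLaceCoefficientPc d Φ) {M : ℕ} (hM2 : 2 ≤ M)
    (hmom : Summable fun x => (1 + euclidNorm x) ^ M * |Φ x|) (l : Fin d) {b : ℕ} (hb : 2 * b ≤ M)
    (hbd : 2 * b + 2 < d) :
    IsFourierPair (coordG d (2 * (b : ℝ)) l) (fun k => (-1 : ℂ) ^ b *
      sliceDeriv (kspaceTwoPoint (laceKernel (criticalProbI d) Φ) (laceSource Φ)) l (2 * b) k) := by
  set sD := sliceDeriv (kspaceTwoPoint (laceKernel (criticalProbI d) Φ) (laceSource Φ)) l (2 * b) with hsD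
  obtain ⟨c₀, hc₀, hlow⟩ := h.exists_knorm_sq_le_norm
  have hint : IntegrableOn sD (cube d) :=
    integrableOn_sliceDeriv_kspaceTwoPoint hM2 (summable_moment_laceKernel hmom _) (summable_moment_laceSource hmom)
      (isZdSymmetric_laceKernel h.symm _) hc₀ hlow l hb hbd
  refine ⟨show IntegrableOn (fun k => (-1 : ℂ) ^ b * sD k) (cube d) volume from hint.const_mul ((-1 : ℂ) ^ b),
    fun y => ?_⟩
  have hid := h.pow_mul_tau_eq_integral hM2 hmom l hb hbd y
  have h2π : ((2 * Real.pi : ℂ)) ^ d ≠ 0 := pow_ne_zero _ (by exact_mod_cast Real.two_pi_pos.ne')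
  have hev : coordG d (2 * (b : ℝ)) l y = ((y l : ℤ) : ℝ) ^ (2 * b) * tau d (criticalProbI d) 0 y := by
    rw [coordG, show (2 * (b : ℝ)) = ((2 * b : ℕ) : ℝ) by push_cast; ring, Real.rpow_natCast, pow_mul,
      sq_abs, ← pow_mul]
  have hpull : ∫ k in cube d, Complex.exp (Complex.I * (kdot k y : ℂ)) * ((-1 : ℂ) ^ b * sD k) =
      (-1 : ℂ) ^ b * ∫ k in cube d, Complex.exp (Complex.I * (kdot k y : ℂ)) * sD k := by
    rw [← integral_const_mul]
    refine setIntegral_congr_fun (measurableSet_cube d) fun k _ => ?_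
    ring
  rw [hev, eq_div_iff h2π]
  show _ = ∫ k in cube d, Complex.exp (Complex.I * (kdot k y : ℂ)) * ((-1 : ℂ) ^ b * sD k)
  rw [hpull]
  refine Eq.trans ?_ hid
  push_cast
  ring

/-- **The fractional engine (Hara 2008, Lemma 1.7 with Lemma 4.2, non-integer exponents below `⌊φ⌋`),
by dyadic second differences.** For a lace-expansion coefficient `Φ = Π_{p_c}` with
`Σ_x (1+|x|)^M |Π(x)| < ∞` (`M ≥ 2`), a non-integer `β > 0` with `⌈β⌉ ≤ M`, and `p ≥ 1` with
`(2 + β)p < d`, the weight `G_l^{(β)} = |x_l|^β τ_{p_c}(0,x)` is `L^p`-dominated: writing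
`β = 2b + θ` (`0 < θ < 2`, `θ ≠ 1`), `|x_l|^β G ≤ c_θ^{-1} w_θ(x_l) x_l^{2b} G(x)` with the dyadic
weight `w_θ` of `LaceExpansionFractionalSmear.lean`, whose representative is the smear
`c_θ^{-1} T_θ[(-1)^b ∂_l^{2b} Ĝ]`, in `L^p` by `FracSmear.lintegral_rpow_smear_lt_top` from the slice
bounds of Lemma 4.1 at the orders `2b`, `2b + r` (`r = 1` if `θ < 1`, `r = 2` if `θ > 1`) — Hara's
"finite as long as `2 + n - ε < d`". [cite: Hara2008, Lemma 1.7, Lemma 4.2 and §4.1.3 ((4.16)–(4.17))] -/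
theorem IsLaceCoefficientPc.lpDominated_coordG_frac {n : ℕ} {Φ : Site (n + 1) → ℝ}
    (h : IsLaceCoefficientPc (n + 1) Φ) (hn : 1 ≤ n) {M : ℕ} (hM2 : 2 ≤ M)
    (hmom : Summable fun x => (1 + euclidNorm x) ^ M * |Φ x|) (l : Fin (n + 1)) {β : ℝ} (hβ0 : 0 < β)
    (hβM : ⌈β⌉₊ ≤ M) (hβ : ∀ z : ℤ, β ≠ z) {p : ℝ} (hp : 1 ≤ p) (hpd : (2 + β) * p < (n + 1 : ℕ)) :
    LpDominated (coordG (n + 1) β l) p := by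
  -- `β = 2b + θ` with `0 < θ < 2`, `θ ≠ 1`
  set b : ℕ := ⌊β / 2⌋₊ with hb
  set θ : ℝ := β - 2 * b with hθ
  have hb2 : (2 * b : ℝ) ≤ β := by
    have : (b : ℝ) ≤ β / 2 := Nat.floor_le (by linarith)
    linarith
  have hθ0 : 0 < θ := by
    rcases hb2.eq_or_lt with heq | hlt
    · exact absurd heq.symm (by
        have := hβ (2 * b)
        push_cast at this
        exact this)
    · rw [hθ]; linarith
  have hθ2 : θ < 2 := by
    have : β / 2 < b + 1 := Nat.lt_floor_add_one (β / 2)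
    rw [hθ]; linarith
  have hθ1 : θ ≠ 1 := by
    intro h1
    refine hβ (2 * b + 1) ?_
    push_cast
    rw [hθ] at h1; linarith
  -- the smoothness order and `2b + r ≤ M`
  set r : ℕ := if θ < 1 then 1 else 2 with hr
  have hr12 : r = 1 ∨ r = 2 := by
    rw [hr]; split_ifs <;> simp
  have hθr : θ < r := by
    rw [hr]; split_ifs with hlt
    · exact_mod_cast hlt
    · push_cast
      exact hθ2
  have hbr : 2 * b + r ≤ M := by
    have hceil : (2 * b + r : ℝ) ≤ ⌈β⌉₊ := by
      have h1 : ((2 * b + r : ℕ) : ℝ) ≤ ⌈β⌉₊ := by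
        have h2 : ((2 * b + r : ℕ) : ℤ) ≤ ⌈β⌉ := by
          refine Int.le_ceil_iff.2 ?_
          rw [hr]
          split_ifs with hlt
          · push_cast
            rw [hθ] at hlt hθ0
            linarith
          · push_cast
            have : 1 < θ := lt_of_le_of_ne (not_lt.1 hlt) (Ne.symm hθ1)
            rw [hθ] at this
            linarith
        have h3 : ((⌈β⌉₊ : ℕ) : ℤ) = ⌈β⌉ := Int.natCast_ceil_eq_ceil hβ0.le
        have h4 : ((2 * b + r : ℕ) : ℤ) ≤ ((⌈β⌉₊ : ℕ) : ℤ) := by rw [h3]; exact h2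
        exact_mod_cast h4
      push_cast at h1
      exact h1
    have : (2 * b + r : ℝ) ≤ M := hceil.trans (by exact_mod_cast hβM)
    exact_mod_cast this
  have hd : 2 * b + 2 < n + 1 := by
    have h1 : (2 + β) * 1 ≤ (2 + β) * p := mul_le_mul_of_nonneg_left hp (by linarith)
    have h2 : 2 + β < (n + 1 : ℕ) := by linarith
    have h3 : (2 * b + 2 : ℝ) < (n + 1 : ℕ) := by linarith
    exact_mod_cast h3
  -- the representative of `x_l^{2b} G`
  set sD := sliceDeriv (kspaceTwoPoint (laceKernel (criticalProbI (n + 1)) Φ) (laceSource Φ)) l (2 * b) with hsD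
  set F₀ : (Fin (n + 1) → ℝ) → ℂ := fun k => (-1 : ℂ) ^ b * sD k with hF₀
  have hpair : IsFourierPair (coordG (n + 1) (2 * (b : ℝ)) l) F₀ :=
    h.isFourierPair_coordG_even hM2 hmom l (by omega) hd
  obtain ⟨c₀, hc₀, hlow⟩ := h.exists_knorm_sq_le_norm
  obtain ⟨C, hC0, hSB⟩ := exists_sliceBound_sliceDeriv_kspaceTwoPoint hM2 (summable_moment_laceKernel hmom _)
    (summable_moment_laceSource hmom) (isZdSymmetric_laceKernel h.symm _) hc₀ hlow l (m := 2 * b) (r := r) hbr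
  have hSB₀ : SliceBound F₀ l ((2 + 2 * b : ℕ) : ℝ) r C :=
    hSB.const_mul (c := (-1 : ℂ) ^ b) (by rw [norm_pow, norm_neg, norm_one, one_pow])
  have hmeas : ∀ t : ℝ, AEStronglyMeasurable (fun k => F₀ (shift l t k))
      ((volume : Measure (Fin (n + 1) → ℝ)).restrict (cube (n + 1))) := fun t =>
    (h.aestronglyMeasurable_sliceDeriv_shift hmom l l (by omega : 2 * b ≤ M) t).const_mul _
  have ha : (0 : ℝ) < ((2 + 2 * b : ℕ) : ℝ) := by positivity
  have haθ : ((2 + 2 * b : ℕ) : ℝ) + θ < n + 1 := by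
    push_cast
    have h1 : (2 + β) * 1 ≤ (2 + β) * p := mul_le_mul_of_nonneg_left hp (by linarith)
    have : (2 : ℝ) + β < (n + 1 : ℕ) := by linarith
    push_cast at this
    rw [hθ]; linarith
  have haθp : (((2 + 2 * b : ℕ) : ℝ) + θ) * p < n + 1 := by
    have : ((2 + 2 * b : ℕ) : ℝ) + θ = 2 + β := by push_cast; rw [hθ]; ring
    rw [this]; exact_mod_cast hpd
  -- the smear represents `w_θ(x_l) x_l^{2b} G(x)`
  have hsmear : IsFourierPair (fun x => fracWeight θ ((x l : ℤ) : ℝ) * coordG (n + 1) (2 * (b : ℝ)) l x)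
      (smear θ l F₀) :=
    hpair.fracWeight_mul l hSB₀.periodic hmeas
      (tsum_lintegral_sdiff_ne_top hn hSB₀ hr12 ha hC0 hθ0 hθr haθ)
  have hLp : ∫⁻ k in cube (n + 1), ‖smear θ l F₀ k‖ₑ ^ p < ⊤ :=
    lintegral_rpow_smear_lt_top hn hSB₀ hr12 ha hC0 hp hθ0 hθr haθp hmeas
  -- domination: `|x_l|^β G ≤ c_θ⁻¹ w_θ(x_l) x_l^{2b} G`
  set cθ : ℝ := (1 - Real.cos (1 / 2)) * (Real.pi / 8) ^ θ with hcθ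
  have hcθpos : 0 < cθ := fracWeight_const_pos
  have hdom : ∀ x : Site (n + 1), coordG (n + 1) β l x ≤
      cθ⁻¹ * (fracWeight θ ((x l : ℤ) : ℝ) * coordG (n + 1) (2 * (b : ℝ)) l x) := by
    intro x
    have hw := mul_abs_rpow_le_fracWeight hθ0 hθ2 (x l)
    have hτ := tau_nonneg (criticalProbI (n + 1)) 0 x
    have hxl : 0 ≤ |((x l : ℤ) : ℝ)| := abs_nonneg _
    have hsplit : |((x l : ℤ) : ℝ)| ^ β = |((x l : ℤ) : ℝ)| ^ θ * |((x l : ℤ) : ℝ)| ^ (2 * (b : ℝ)) := by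
      rw [← Real.rpow_add_of_nonneg hxl hθ0.le (by positivity)]
      congr 1; rw [hθ]; ring
    unfold coordG
    rw [hsplit]
    have h1 : |((x l : ℤ) : ℝ)| ^ θ ≤ cθ⁻¹ * fracWeight θ ((x l : ℤ) : ℝ) := by
      rw [le_inv_mul_iff₀ hcθpos]
      exact hw
    calc |((x l : ℤ) : ℝ)| ^ θ * |((x l : ℤ) : ℝ)| ^ (2 * (b : ℝ)) * tau (n + 1) (criticalProbI (n + 1)) 0 x
        ≤ cθ⁻¹ * fracWeight θ ((x l : ℤ) : ℝ) * |((x l : ℤ) : ℝ)| ^ (2 * (b : ℝ)) *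
            tau (n + 1) (criticalProbI (n + 1)) 0 x := by
          gcongr
      _ = cθ⁻¹ * (fracWeight θ ((x l : ℤ) : ℝ) * (|((x l : ℤ) : ℝ)| ^ (2 * (b : ℝ)) *
            tau (n + 1) (criticalProbI (n + 1)) 0 x)) := by ring
  have hnn : ∀ x : Site (n + 1), 0 ≤ fracWeight θ ((x l : ℤ) : ℝ) * coordG (n + 1) (2 * (b : ℝ)) l x :=
    fun x => mul_nonneg (fracWeight_nonneg _ _) (coordG_nonneg _ _ _ _)
  have hdom' := (LpDominated.of_global hnn (fun _ => le_rfl) hsmear hLp).const_mul (by linarith : (0 : ℝ) ≤ p)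
    (inv_nonneg.2 hcθpos.le)
  exact hdom'.mono hdom

/-- The fractional engine from a real moment `Σ_x |x|^φ |Π(x)| < ∞` (`φ ≥ 2`), in the shape of the
hypothesis `hfrac` of `Hara2008_lemma17Pc_of_engines` (`LaceExpansionXSpaceNormsProofs.lean`): for
`d ≥ 3`, non-integer `0 < β < ⌊φ⌋`, `p ≥ 1`, `(2 + β)p < d`, `G_j^{(β)}` is `L^p`-dominated.
[cite: Hara2008, Lemma 1.7, Lemma 4.2 and §4.1.3] -/
theorem IsLaceCoefficientPc.lpDominated_coordG_frac_of_rpow (h : IsLaceCoefficientPc d Φ) (hd : 3 ≤ d)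
    {φ : ℝ} (hφ2 : 2 ≤ φ) (hmom : Summable fun x => euclidNorm x ^ φ * |Φ x|) (j : Fin d) {β p : ℝ}
    (hβ0 : 0 < β) (hβφ : β < ⌊φ⌋₊) (hβ : ∀ z : ℤ, β ≠ z) (hp : 1 ≤ p) (hpd : (2 + β) * p < d) :
    LpDominated (coordG d β j) p := by
  obtain ⟨n, rfl⟩ : ∃ n, d = n + 1 := ⟨d - 1, by omega⟩
  have hM : Summable fun x => (1 + euclidNorm x) ^ ⌊φ⌋₊ * |Φ x| :=
    summable_one_add_pow_mul_abs_of_rpow (Nat.floor_le (by linarith)) h.summable_abs hmom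
  have h2 : 2 ≤ ⌊φ⌋₊ := Nat.le_floor (by exact_mod_cast hφ2)
  exact h.lpDominated_coordG_frac (by omega) h2 hM j hβ0 (Nat.ceil_le.2 hβφ.le) hβ hp hpd

/-- **The fractional engine of `Hara2008_lemma17Pc`** — the hypothesis `hfrac` of
`Hara2008_lemma17Pc_of_engines` discharged: for every `d ≥ 11`, every lace-expansion coefficient
with `Σ_x |x|^φ |Π(x)| < ∞` (`φ ≥ 2`), every non-integer `0 < β < ⌊φ⌋` and `p ≥ 1` with
`(2 + β)p < d`, `G_j^{(β)} = |x_j|^β τ_{p_c}(0,x)` is `L^p`-dominated.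
[cite: Hara2008, Lemma 1.7, Lemma 4.2 and §4.1.3] -/
theorem Hara2008_lemma17Pc_hfrac :
    ∀ (d : ℕ), 11 ≤ d → ∀ Φ : Site d → ℝ, IsLaceCoefficientPc d Φ → ∀ φ : ℝ, 2 ≤ φ →
      (Summable fun x : Site d => euclidNorm x ^ φ * |Φ x|) →
      ∀ (j : Fin d) (β p : ℝ), 0 < β → β < ⌊φ⌋₊ → (∀ n : ℤ, β ≠ n) → 1 ≤ p → (2 + β) * p < d →
        LpDominated (coordG d β j) p :=
  fun _d hd _Φ hΦ _φ hφ2 hmom j _β _p hβ0 hβφ hβ hp hpd =>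
    hΦ.lpDominated_coordG_frac_of_rpow (by omega) hφ2 hmom j hβ0 hβφ hβ hp hpd

end AtPc

end Literature.Barriers.CriticalPhenomena
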